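import Summits.FinalStateConjecture.FinalStateConjecture.Theorems.PhotonSphereChannelsDarkFutureDefs
import Literature.Analysis.Calculus.DerivativeInterpolationLocal
import HarnessLib

/-!
# Route PhotonSphereChannels · crux `ChannelsResolveTameDevelopmentsR` — line
# `dark-future-exactness`, glue sub-goal `isNonRadiating_allOrders`: non-radiation at every order
# from non-radiation at order zero plus weighted far bounds of all orders

Prover-written support file (`--supports stmt-FinalStateConjecture-17430`), closing the registered
glue sub-goal `isNonRadiating_allOrders` of the lead's stub N of the line `dark-future-exactness`.

The line's silent ends are two-sided non-radiating at order `1/r` only for `m ≤ 2`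
(`EndDatum.IsNonRadiating`: `r · ‖Dᵐ ∂₀ h‖ → 0` as `r → ∞`, uniformly in `x⁰`, `m ≤ 2`), while
the eternal-Papapetrou / stationary-is-Kerr cruxes it feeds need it for all `m < k`. With the
ALL-ORDERS weighted far bounds `‖Dᵐ h‖ · r ≤ Λ k` (`m ≤ k`, the class `IsTameClass`) this is pure
interpolation on the far cylinder `Kerr.region 0 R = ℝ × {r > max R 0}`:

* `isNonRadiating_allOrders` — for an end datum `E` with `0 < E.R`, `h = E.h` smooth at every point
  of the (open) far cylinder, `‖Dᵐ h‖ · r ≤ Λ k` there for `m ≤ k`, and `E.IsNonRadiating`, one has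
  for every `m` and `δ > 0` an `R'` with `‖Dᵐ ∂₀h (x)‖ · r(x) ≤ δ` whenever `r(x) > R'`.

Proof (Landau 1913 / Kolmogorov interpolation, in the packaged form
`Literature.Analysis.Calculus.eventually_norm_iteratedFDeriv_lt_of_contDiffAt`): index the family
`g_x (v) := r(x) · ∂₀h (x + v)` on the unit ball of `E4` by the base point `x` of the cylinder and
let `r(x) → ∞`. Since `r = ‖x⃗‖` is `1`-Lipschitz, for `r(x) ≥ 2 (max R 0 + 1)` the unit ball
around `x` lies in the cylinder with `r(x) ≤ 2 r(x + v)`; hence `‖Dᵏ g_x‖ ≤ 2 Λ (k+1)` on the unit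
ball for every `k` (`‖Dᵏ ∂₀ h‖ ≤ ‖Dᵏ⁺¹ h‖`, `norm_iteratedFDeriv_clm_apply_const`), and
`‖g_x‖ → 0` uniformly on the unit ball by non-radiation at order `0`. The interpolation lemma gives
`‖Dᵐ g_x‖ → 0` uniformly on the ball of radius `2⁻ᵐ`, in particular at its centre:
`r(x) ‖Dᵐ ∂₀h (x)‖ → 0`. Only the case `m = 0` of `IsNonRadiating` is used.
-/

noncomputable section

-- the operator-norm instance on `E4 →L[ℝ] E4 →L[ℝ] ℝ` needs one more level of pending
-- instance problems than the default (as in `PhotonSphereChannelsTameHullDefs.lean`)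
set_option maxSynthPendingDepth 3
-- every `Summit.FinalStateConjecture.FinalStateConjecture.…` name repeats the summit = sub-problem
-- segment (D-0017 layout)
set_option linter.dupNamespace false

open Set Filter Function TopologicalSpace Manifold Bundle
open scoped Topology Manifold ContDiff ENNReal NNReal

namespace Summit.FinalStateConjecture.FinalStateConjecture.Theorems.DarkFuture

open Literature.Geometry.Lorentzian
open Summit.FinalStateConjecture.FinalStateConjecture.Theorems.TameHull

/-- `‖x⃗‖ ≤ ‖x‖` on `E4`: the spatial projection is a contraction (as
`Literature.Geometry.Lorentzian.E4.spatialNorm_le_norm` of `KerrSchildEnergyEstimate.lean`, reproved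
here to keep the imports of this glue file minimal). [folklore] -/
private theorem spatialNorm_le_norm (x : E4) : E4.spatialNorm x ≤ ‖x‖ := by
  have hs : 0 ≤ E4.spatialNorm x := E4.spatialNorm_nonneg x
  have hsq : ‖x‖ ^ 2 = x 0 ^ 2 + E4.spatialNorm x ^ 2 := by
    rw [EuclideanSpace.norm_sq_eq, Fin.sum_univ_four, E4.spatialNorm_sq]
    simp only [Real.norm_eq_abs, sq_abs]
    ring
  nlinarith [norm_nonneg x, sq_nonneg (x 0)]

/-- The Schwarzschild area radius `r = ‖x⃗‖` of the `a = 0` Kerr–Schild chart is `1`-Lipschitz: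
`r(x) - r(y) ≤ ‖x - y‖`. [folklore] -/
private theorem radius_sub_le (x y : E4) : Kerr.radius 0 x - Kerr.radius 0 y ≤ ‖x - y‖ := by
  rw [Kerr.radius_zero_left, Kerr.radius_zero_left, E4.spatialNorm, E4.spatialNorm]
  calc ‖E4.spatial x‖ - ‖E4.spatial y‖ ≤ ‖E4.spatial x - E4.spatial y‖ := norm_sub_norm_le _ _
    _ = E4.spatialNorm (x - y) := by rw [← map_sub]; rfl
    _ ≤ ‖x - y‖ := spatialNorm_le_norm _

/-- **Non-radiation at every order** (registered glue sub-goal `isNonRadiating_allOrders` of crux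
stmt-FinalStateConjecture-17430, line `dark-future-exactness`). For an end datum `E` with
`0 < E.R` whose far deviation `h` is `C^∞` at every point of the far cylinder `Kerr.region 0 E.R`
and satisfies the all-orders weighted far bounds `‖Dᵐ h‖ · r ≤ Λ k` (`m ≤ k`), two-sided
non-radiation at order `1/r` for `m ≤ 2` (`E.IsNonRadiating`; only `m = 0` is used) upgrades to
every order: `r · ‖Dᵐ ∂₀ h‖ → 0` as `r → ∞`, uniformly in `x⁰ ∈ ℝ`, for all `m` — Landau–Kolmogorov
interpolation between the orders `0` and `m + 1, m + 2, …` on unit balls of the far cylinder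
(`Literature.Analysis.Calculus.eventually_norm_iteratedFDeriv_lt_of_contDiffAt` applied to the
family `v ↦ r(x) · ∂₀h (x + v)` indexed by the base point, along `r(x) → ∞`). [folklore] -/
theorem isNonRadiating_allOrders : ∀ {𝓢 : Spacetime.{0} 4} (E : EndDatum 𝓢) (Λ : ℕ → ℝ≥0), 0 < E.R → (∀ x : Kerr.region (0 : ℝ) E.R, ContDiffAt ℝ ∞ E.h x.1) → (∀ k : ℕ, ∀ m ≤ k, ∀ x : Kerr.region (0 : ℝ) E.R, ‖iteratedFDeriv ℝ m E.h x.1‖ * Kerr.radius 0 x.1 ≤ Λ k) → E.IsNonRadiating → ∀ (m : ℕ), ∀ δ > (0 : ℝ), ∃ R' : ℝ, ∀ x : Kerr.region (0 : ℝ) E.R, R' < Kerr.radius 0 x.1 → ‖iteratedFDeriv ℝ m E.hdot x.1‖ * Kerr.radius 0 x.1 ≤ δ := by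
  intro 𝓢 E Λ hR hsmooth hΛ hNR m δ hδ
  have hle : ∀ n : ℕ, (n : ℕ∞ω) ≤ ((⊤ : ℕ∞) : ℕ∞ω) := fun n => by
    exact_mod_cast (WithTop.coe_lt_coe.2 (ENat.coe_lt_top n)).le
  -- the open far cylinder
  set U : Set E4 := (Kerr.region (0 : ℝ) E.R : Set E4) with hU_def
  have hmemU : ∀ {z : E4}, z ∈ U ↔ max E.R 0 < Kerr.radius 0 z := fun {z} => Iff.rfl
  -- `hdot = ∂₀ h` is smooth on the cylinder, with `‖Dⁿ hdot‖ ≤ ‖Dⁿ⁺¹ h‖`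
  have hfd : ∀ z ∈ U, ∀ n : ℕ, ContDiffAt ℝ n (fderiv ℝ E.h) z := fun z hz n =>
    (hsmooth ⟨z, hz⟩).fderiv_right (by exact_mod_cast hle (n + 1))
  have hdotC : ∀ z ∈ U, ContDiffAt ℝ ∞ E.hdot z := fun z hz =>
    ((hsmooth ⟨z, hz⟩).fderiv_right (m := ((⊤ : ℕ∞) : ℕ∞ω))
      (by rw [ENat.coe_top_add_one])).clm_apply contDiffAt_const
  have hdotD : ∀ z ∈ U, ∀ n : ℕ,
      ‖iteratedFDeriv ℝ n E.hdot z‖ ≤ ‖iteratedFDeriv ℝ (n + 1) E.h z‖ := by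
    intro z hz n
    have h := norm_iteratedFDeriv_clm_apply_const (f := fderiv ℝ E.h) (c := E4.basisVector 0)
      (n := n) (x := z) (hfd z hz n) le_rfl
    have h1 : ‖(E4.basisVector 0 : E4)‖ = 1 := by simp
    rw [h1, one_mul, norm_iteratedFDeriv_fderiv] at h
    exact h
  -- geometry of unit balls far out on the cylinder: inside the cylinder, comparable radius
  set R₂ : ℝ := 2 * (max E.R 0 + 1) with hR₂_def
  have hfar : ∀ x y : E4, R₂ ≤ Kerr.radius 0 x → ‖y‖ < 1 →
      x + y ∈ U ∧ Kerr.radius 0 x - 1 < Kerr.radius 0 (x + y) ∧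
        Kerr.radius 0 x ≤ 2 * Kerr.radius 0 (x + y) := by
    intro x y hx hy
    have h1 : Kerr.radius 0 x - Kerr.radius 0 (x + y) ≤ ‖y‖ := by
      simpa using radius_sub_le x (x + y)
    have hmax : 0 ≤ max E.R 0 := le_max_right _ _
    refine ⟨?_, by linarith, by linarith⟩
    rw [hmemU]
    linarith
  -- the family of unit-ball restrictions of `hdot`, weighted by the radius of the base point,
  -- along the filter `r(base point) → ∞`
  let ι := Kerr.region (0 : ℝ) E.R
  let l : Filter ι := Filter.comap (fun x : ι => Kerr.radius 0 x.1) atTop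
  let g : ι → E4 → (E4 →L[ℝ] E4 →L[ℝ] ℝ) := fun x v => Kerr.radius 0 x.1 • E.hdot (x.1 + v)
  have hl : ∀ R₀ : ℝ, ∀ᶠ x in l, R₀ ≤ Kerr.radius 0 x.1 := fun R₀ =>
    (Filter.tendsto_comap (f := fun x : ι => Kerr.radius 0 x.1)).eventually
      (eventually_ge_atTop R₀)
  have hgD : ∀ (x : ι) (y : E4), x.1 + y ∈ U → ∀ n : ℕ,
      iteratedFDeriv ℝ n (g x) y = Kerr.radius 0 x.1 • iteratedFDeriv ℝ n E.hdot (x.1 + y) := by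
    intro x y hxy n
    have hC : ContDiffAt ℝ n (fun v => E.hdot (x.1 + v)) y :=
      ((hdotC _ hxy).of_le (hle n)).comp y (contDiffAt_const.add contDiffAt_id)
    change iteratedFDeriv ℝ n (fun v => Kerr.radius 0 x.1 • E.hdot (x.1 + v)) y = _
    rw [iteratedFDeriv_const_smul_apply' hC, iteratedFDeriv_comp_add_left]
  -- (a) eventually smooth on the unit ball
  have hg : ∀ᶠ x in l, ∀ y ∈ Metric.ball (0 : E4) 1, ContDiffAt ℝ ∞ (g x) y := by
    filter_upwards [hl R₂] with x hx y hy
    rw [Metric.mem_ball, dist_zero_right] at hy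
    have hxy := (hfar x.1 y hx hy).1
    exact ((hdotC _ hxy).comp y (contDiffAt_const.add contDiffAt_id)).const_smul _
  -- (b) every derivative eventually bounded on the unit ball, by `2 Λ (k + 1)`
  have hb : ∀ k : ℕ, ∃ M : ℝ, ∀ᶠ x in l, ∀ y ∈ Metric.ball (0 : E4) 1,
      ‖iteratedFDeriv ℝ k (g x) y‖ ≤ M := by
    intro k
    refine ⟨2 * Λ (k + 1), ?_⟩
    filter_upwards [hl R₂] with x hx y hy
    rw [Metric.mem_ball, dist_zero_right] at hy
    obtain ⟨hxy, -, h2⟩ := hfar x.1 y hx hy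
    have hΛ' := hΛ (k + 1) (k + 1) le_rfl ⟨x.1 + y, hxy⟩
    rw [hgD x y hxy, norm_smul, Real.norm_of_nonneg (Kerr.radius_nonneg _ _)]
    calc Kerr.radius 0 x.1 * ‖iteratedFDeriv ℝ k E.hdot (x.1 + y)‖
        ≤ (2 * Kerr.radius 0 (x.1 + y)) * ‖iteratedFDeriv ℝ (k + 1) E.h (x.1 + y)‖ :=
          mul_le_mul h2 (hdotD _ hxy k) (norm_nonneg _)
            (mul_nonneg zero_le_two (Kerr.radius_nonneg _ _))
      _ = 2 * (‖iteratedFDeriv ℝ (k + 1) E.h (x.1 + y)‖ * Kerr.radius 0 (x.1 + y)) := by ring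
      _ ≤ 2 * Λ (k + 1) := by gcongr
  -- (c) the functions tend to `0` uniformly on the unit ball: non-radiation at order `0`
  have h0 : ∀ ε > 0, ∀ᶠ x in l, ∀ y ∈ Metric.ball (0 : E4) 1, ‖g x y‖ < ε := by
    intro ε hε
    obtain ⟨R₀, hR₀⟩ := hNR 0 (by norm_num) (ε / 4) (by positivity)
    filter_upwards [hl R₂, hl (R₀ + 1)] with x hx hx' y hy
    rw [Metric.mem_ball, dist_zero_right] at hy
    obtain ⟨hxy, h1, h2⟩ := hfar x.1 y hx hy
    have hz := hR₀ ⟨x.1 + y, hxy⟩ (by simp only; linarith)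
    rw [norm_iteratedFDeriv_zero] at hz
    change ‖Kerr.radius 0 x.1 • E.hdot (x.1 + y)‖ < ε
    rw [norm_smul, Real.norm_of_nonneg (Kerr.radius_nonneg _ _)]
    calc Kerr.radius 0 x.1 * ‖E.hdot (x.1 + y)‖
        ≤ (2 * Kerr.radius 0 (x.1 + y)) * ‖E.hdot (x.1 + y)‖ :=
          mul_le_mul_of_nonneg_right h2 (norm_nonneg _)
      _ = 2 * (‖E.hdot (x.1 + y)‖ * Kerr.radius 0 (x.1 + y)) := by ring
      _ ≤ 2 * (ε / 4) := by gcongr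
      _ < ε := by linarith
  -- Landau–Kolmogorov interpolation on the unit balls: all derivatives of the family decay
  have key := Literature.Analysis.Calculus.eventually_norm_iteratedFDeriv_lt_of_contDiffAt
    (p := (0 : E4)) one_pos hg hb h0 m δ hδ
  -- unpack the filter statement at the centre of the ball
  obtain ⟨R₁, hR₁⟩ := Filter.eventually_atTop.1 (Filter.eventually_comap.1 (key.and (hl R₂)))
  refine ⟨R₁, fun x hx => ?_⟩
  obtain ⟨hxm, -⟩ := hR₁ (Kerr.radius 0 x.1) hx.le x rfl
  have hx0 : x.1 + 0 ∈ U := by rw [add_zero]; exact x.2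
  have h := hxm 0 (Metric.mem_ball_self (by positivity))
  rw [hgD x 0 hx0, add_zero, norm_smul, Real.norm_of_nonneg (Kerr.radius_nonneg _ _)] at h
  rw [mul_comm]
  exact h.le

end Summit.FinalStateConjecture.FinalStateConjecture.Theorems.DarkFuture

end
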